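import Mathlib

/-!
# THEOREM clean-CE₄ (split letters) — kernel leg (hsemireg-alphabet-isogeny-1 g10)

EVIDENCE for the LINE `stmt-HodgeConjecture-18881 Cruxes/BlochSeedDiscOne/Lines/birth.lean 814a6a70c14e831a
stub_rung_pad4_seedAt`, not a rung.  Nothing here is proved toward HC ∕ HC_CM ∕ HC_AV ∕ №4 ∕ 26512 ∕ 18881 ∕ H2.
Mathlib-only; no `sorry`, no `instance`, no `notation`, no `allowUnsafeReducibility`.

Memo of record: `run/shared/lean/pub/pub-hsemireg/hsemireg-alphabet-isogeny-1/SPEC-ISOGENY-ALPHABET-isogeny1-g10.md`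
(«THEOREM clean-CE₄: under the class screen (H1) in degrees ≤ 4, four LETTERS never carry μ ≠ 0»).

THE STATEMENT BEING SUPPORTED (memo §1).  In the commutative algebra 𝒜 = ⊕ₖ 𝒜ᵏ of constant `(k,k)`-classes on the
Weil-type abelian 8-fold `X = V/Λ`, `V = ℂ⁸ = V_A ⊕ V_B`, with `h ↔ I₈` and `W = ⟨ω_AB, ω_BA⟩ ⊂ 𝒜⁴`: if four letters
`ω₁ … ω₄ ∈ 𝒜¹` (↔ hermitian 8×8 matrices, repeats allowed) satisfy `e_k(ω) = a_k hᵏ (k ≤ 3)` and `e₄(ω) = a₄ h⁴ + w`,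
`w ∈ W_ℂ`, then `w = 0`.

WHAT IS KERNEL-CHECKED HERE (generic commutative-ring ∕ field algebra; the dictionary 𝒜⁴ ≅ Mat₇₀(ℂ), `∧ ↦` mixed
compound, is engine-checked exactly in `code/g10/cleance4_check.py` and NOT formalised):
* §1 the MECHANISM — the single-letter identity: from the four (H1)≤4 hypotheses, for EACH letter `ω_b`,
  `ω_b⁴ − a₁ h ω_b³ + a₂ h² ω_b² − a₃ h³ ω_b + a₄ h⁴ = −w` (`G_letter_eq_neg_w`), because `F(T) = Π (T − ω_a)` vanishes at
  `T = ω_b` (`chernPoly_root`) and `F = G + w` coefficientwise (`chernPoly_expand`); and the SPLIT form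
  `Π_j (ω_b − ρ_j h) = −w` once `a_k = e_k(ρ)` (`G_split`, `G_split_letter_eq_neg_w`).
* §2 the TRANSFER between the screen on `ch` (power sums) and on `c` (elementary symmetric functions): Newton's
  identities for four letters (`newton₁ … newton₄`) and `24·e₄ = … − 6·p₄` (`e_from_p`), so the `W`-part of `e₄` is
  `−(1/4)` × the `W`-part of `p₄ = 4!·ch₄` (`transfer_W_part`).
* §3 the COORDINATE SKELETON of the eigenvector step: a diagonal operator's θ-eigenvectors are supported on
  `{i : d i = θ}` (`support_of_diag_eigen`) — applied in the decomposable eigenbasis `u_S` of `Φ₄(G(ω_b))`; and the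
  CORNER `N = α E_AB + β E_BA`: a θ-eigenvector with `θ ≠ 0` is supported on `{A, B}`, has BOTH corner coordinates
  non-zero or both zero, forces `θ² = αβ`, and is unique up to scalar (`corner_*`).  The last pencil step — «a 4-vector
  with both pure coordinates `e_A`, `e_B` non-zero and nothing else is NOT decomposable» — is the annihilator-rank
  computation (c) of the engine (rank 8 ≠ 4), not formalised.
-/

namespace HsemiregIsogeny1.CleanCE4

/-! ## §1 The mechanism: `F(ω_b) = 0` and `F = G + w` give `G(ω_b) = −w` for every letter -/

section Mechanism

variable {A : Type*} [CommRing A]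

/-- elementary symmetric functions of four letters -/
def e₁ (x₁ x₂ x₃ x₄ : A) : A := x₁ + x₂ + x₃ + x₄
/-- `e₂` -/
def e₂ (x₁ x₂ x₃ x₄ : A) : A := x₁ * x₂ + x₁ * x₃ + x₁ * x₄ + x₂ * x₃ + x₂ * x₄ + x₃ * x₄
/-- `e₃` -/
def e₃ (x₁ x₂ x₃ x₄ : A) : A := x₁ * x₂ * x₃ + x₁ * x₂ * x₄ + x₁ * x₃ * x₄ + x₂ * x₃ * x₄
/-- `e₄` -/
def e₄ (x₁ x₂ x₃ x₄ : A) : A := x₁ * x₂ * x₃ * x₄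

/-- the Chern polynomial of the four letters evaluated at `t`: `F(t) = Π_a (t − ω_a)` -/
def chernPoly (ω₁ ω₂ ω₃ ω₄ t : A) : A := (t - ω₁) * (t - ω₂) * (t - ω₃) * (t - ω₄)

/-- the CLEAN quartic `G(t) = t⁴ − a₁ h t³ + a₂ h² t² − a₃ h³ t + a₄ h⁴` (the `ℚ[h]`-part of `F`) -/
def cleanPoly (a₁ a₂ a₃ a₄ h t : A) : A := t ^ 4 - a₁ * h * t ^ 3 + a₂ * h ^ 2 * t ^ 2 - a₃ * h ^ 3 * t + a₄ * h ^ 4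

theorem chernPoly_expand (ω₁ ω₂ ω₃ ω₄ t : A) :
    chernPoly ω₁ ω₂ ω₃ ω₄ t =
      t ^ 4 - e₁ ω₁ ω₂ ω₃ ω₄ * t ^ 3 + e₂ ω₁ ω₂ ω₃ ω₄ * t ^ 2 - e₃ ω₁ ω₂ ω₃ ω₄ * t + e₄ ω₁ ω₂ ω₃ ω₄ := by
  unfold chernPoly e₁ e₂ e₃ e₄; ring

/-- every letter is a root of the Chern polynomial (the algebra is commutative) -/
theorem chernPoly_root (ω₁ ω₂ ω₃ ω₄ : A) :
    chernPoly ω₁ ω₂ ω₃ ω₄ ω₁ = 0 ∧ chernPoly ω₁ ω₂ ω₃ ω₄ ω₂ = 0 ∧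
      chernPoly ω₁ ω₂ ω₃ ω₄ ω₃ = 0 ∧ chernPoly ω₁ ω₂ ω₃ ω₄ ω₄ = 0 := by
  unfold chernPoly; refine ⟨?_, ?_, ?_, ?_⟩ <;> ring

/-- **THE MECHANISM.** Under the class screen (H1) in degrees `≤ 4` — `e_k(ω) = a_k hᵏ` for `k ≤ 3` and
`e₄(ω) = a₄ h⁴ + w` — the clean quartic takes the value `−w` at EVERY letter. -/
theorem G_letter_eq_neg_w (ω₁ ω₂ ω₃ ω₄ a₁ a₂ a₃ a₄ h w : A)
    (h1 : e₁ ω₁ ω₂ ω₃ ω₄ = a₁ * h) (h2 : e₂ ω₁ ω₂ ω₃ ω₄ = a₂ * h ^ 2)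
    (h3 : e₃ ω₁ ω₂ ω₃ ω₄ = a₃ * h ^ 3) (h4 : e₄ ω₁ ω₂ ω₃ ω₄ = a₄ * h ^ 4 + w) :
    cleanPoly a₁ a₂ a₃ a₄ h ω₁ = -w ∧ cleanPoly a₁ a₂ a₃ a₄ h ω₂ = -w ∧
      cleanPoly a₁ a₂ a₃ a₄ h ω₃ = -w ∧ cleanPoly a₁ a₂ a₃ a₄ h ω₄ = -w := by
  unfold e₁ at h1; unfold e₂ at h2; unfold e₃ at h3; unfold e₄ at h4
  unfold cleanPoly
  refine ⟨?_, ?_, ?_, ?_⟩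
  · linear_combination ω₁ ^ 3 * h1 - ω₁ ^ 2 * h2 + ω₁ * h3 - h4
  · linear_combination ω₂ ^ 3 * h1 - ω₂ ^ 2 * h2 + ω₂ * h3 - h4
  · linear_combination ω₃ ^ 3 * h1 - ω₃ ^ 2 * h2 + ω₃ * h3 - h4
  · linear_combination ω₄ ^ 3 * h1 - ω₄ ^ 2 * h2 + ω₄ * h3 - h4

/-- the SPLIT form of the clean quartic: if `x⁴ − a₁x³ + a₂x² − a₃x + a₄ = Π_j (x − ρ_j)` over the scalars
(i.e. `a_k = e_k(ρ)`; over `ℂ` every quartic splits), then `G(t) = Π_j (t − ρ_j h)`. -/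
theorem G_split (ρ₁ ρ₂ ρ₃ ρ₄ h t : A) :
    cleanPoly (e₁ ρ₁ ρ₂ ρ₃ ρ₄) (e₂ ρ₁ ρ₂ ρ₃ ρ₄) (e₃ ρ₁ ρ₂ ρ₃ ρ₄) (e₄ ρ₁ ρ₂ ρ₃ ρ₄) h t =
      (t - ρ₁ * h) * (t - ρ₂ * h) * (t - ρ₃ * h) * (t - ρ₄ * h) := by
  unfold cleanPoly e₁ e₂ e₃ e₄; ring

/-- **(★) of the memo**: `Π_j (ω_b − ρ_j h) = −w` for every letter `ω_b`, from (H1)≤4 with `a_k = e_k(ρ)`. -/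
theorem G_split_letter_eq_neg_w (ω₁ ω₂ ω₃ ω₄ ρ₁ ρ₂ ρ₃ ρ₄ h w : A)
    (h1 : e₁ ω₁ ω₂ ω₃ ω₄ = e₁ ρ₁ ρ₂ ρ₃ ρ₄ * h) (h2 : e₂ ω₁ ω₂ ω₃ ω₄ = e₂ ρ₁ ρ₂ ρ₃ ρ₄ * h ^ 2)
    (h3 : e₃ ω₁ ω₂ ω₃ ω₄ = e₃ ρ₁ ρ₂ ρ₃ ρ₄ * h ^ 3) (h4 : e₄ ω₁ ω₂ ω₃ ω₄ = e₄ ρ₁ ρ₂ ρ₃ ρ₄ * h ^ 4 + w) :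
    (ω₁ - ρ₁ * h) * (ω₁ - ρ₂ * h) * (ω₁ - ρ₃ * h) * (ω₁ - ρ₄ * h) = -w ∧
    (ω₂ - ρ₁ * h) * (ω₂ - ρ₂ * h) * (ω₂ - ρ₃ * h) * (ω₂ - ρ₄ * h) = -w ∧
    (ω₃ - ρ₁ * h) * (ω₃ - ρ₂ * h) * (ω₃ - ρ₃ * h) * (ω₃ - ρ₄ * h) = -w ∧
    (ω₄ - ρ₁ * h) * (ω₄ - ρ₂ * h) * (ω₄ - ρ₃ * h) * (ω₄ - ρ₄ * h) = -w := by
  have H := G_letter_eq_neg_w ω₁ ω₂ ω₃ ω₄ _ _ _ _ h w h1 h2 h3 h4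
  simp only [G_split] at H
  exact H

/-- SCOPE REMARK (why `N = 4` letters is essential): with FIVE letters the same bookkeeping gives
`Π_j (ω_b − ρ_j h) · ω_b`-type identities — here is the exact five-letter identity: `F₅(ω₁) = 0` where the
degree-4 coefficient now multiplies `ω₁`; no contradiction with a top-degree Weil part follows (memo §1.6). -/
theorem five_letters_root (ω₁ ω₂ ω₃ ω₄ ω₅ : A) :
    (ω₁ - ω₁) * (ω₁ - ω₂) * (ω₁ - ω₃) * (ω₁ - ω₄) * (ω₁ - ω₅) = 0 := by ring

end Mechanism

/-! ## §2 Transfer: the screen on `ch` (power sums) versus on `c` (elementary symmetric functions) -/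

section Transfer

variable {A : Type*} [CommRing A]

/-- power sums `p_k = Σ_a ω_aᵏ = k! · ch_k` of four letters -/
def p (k : ℕ) (x₁ x₂ x₃ x₄ : A) : A := x₁ ^ k + x₂ ^ k + x₃ ^ k + x₄ ^ k

theorem newton₁ (x₁ x₂ x₃ x₄ : A) : p 1 x₁ x₂ x₃ x₄ = e₁ x₁ x₂ x₃ x₄ := by unfold p e₁; ring

theorem newton₂ (x₁ x₂ x₃ x₄ : A) :
    p 2 x₁ x₂ x₃ x₄ = e₁ x₁ x₂ x₃ x₄ * p 1 x₁ x₂ x₃ x₄ - 2 * e₂ x₁ x₂ x₃ x₄ := by unfold p e₁ e₂; ring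

theorem newton₃ (x₁ x₂ x₃ x₄ : A) :
    p 3 x₁ x₂ x₃ x₄ = e₁ x₁ x₂ x₃ x₄ * p 2 x₁ x₂ x₃ x₄ - e₂ x₁ x₂ x₃ x₄ * p 1 x₁ x₂ x₃ x₄
      + 3 * e₃ x₁ x₂ x₃ x₄ := by unfold p e₁ e₂ e₃; ring

theorem newton₄ (x₁ x₂ x₃ x₄ : A) :
    p 4 x₁ x₂ x₃ x₄ = e₁ x₁ x₂ x₃ x₄ * p 3 x₁ x₂ x₃ x₄ - e₂ x₁ x₂ x₃ x₄ * p 2 x₁ x₂ x₃ x₄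
      + e₃ x₁ x₂ x₃ x₄ * p 1 x₁ x₂ x₃ x₄ - 4 * e₄ x₁ x₂ x₃ x₄ := by unfold p e₁ e₂ e₃ e₄; ring

/-- the `e`'s from the `p`'s with integer denominators cleared: `2e₂ = p₁² − p₂`, `6e₃ = p₁³ − 3p₁p₂ + 2p₃`,
`24e₄ = p₁⁴ − 6p₁²p₂ + 3p₂² + 8p₁p₃ − 6p₄`. -/
theorem e_from_p (x₁ x₂ x₃ x₄ : A) :
    2 * e₂ x₁ x₂ x₃ x₄ = p 1 x₁ x₂ x₃ x₄ ^ 2 - p 2 x₁ x₂ x₃ x₄ ∧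
    6 * e₃ x₁ x₂ x₃ x₄ = p 1 x₁ x₂ x₃ x₄ ^ 3 - 3 * p 1 x₁ x₂ x₃ x₄ * p 2 x₁ x₂ x₃ x₄ + 2 * p 3 x₁ x₂ x₃ x₄ ∧
    24 * e₄ x₁ x₂ x₃ x₄ = p 1 x₁ x₂ x₃ x₄ ^ 4 - 6 * p 1 x₁ x₂ x₃ x₄ ^ 2 * p 2 x₁ x₂ x₃ x₄
      + 3 * p 2 x₁ x₂ x₃ x₄ ^ 2 + 8 * p 1 x₁ x₂ x₃ x₄ * p 3 x₁ x₂ x₃ x₄ - 6 * p 4 x₁ x₂ x₃ x₄ := by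
  unfold p e₂ e₃ e₄; refine ⟨?_, ?_, ?_⟩ <;> ring

/-- **TRANSFER of the `W`-part.** If the power sums are clean — `p_k = b_k hᵏ (k ≤ 3)`, `p₄ = b₄ h⁴ + w'` — then the
elementary symmetric functions are clean with denominators `1, 2, 6, 24` and `24·e₄ = (…)·h⁴ − 6·w'`: the `W`-part of
`e₄` is `−w'/4`, non-zero iff that of `p₄ = 24·ch₄` is (over a `ℚ`-algebra).  This is the passage between the screen
(A1) stated on `ch(E)` and the hypotheses of `G_letter_eq_neg_w` (with `24·(…)` cleared there by rescaling). -/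
theorem transfer_W_part (x₁ x₂ x₃ x₄ b₁ b₂ b₃ b₄ h w' : A)
    (q1 : p 1 x₁ x₂ x₃ x₄ = b₁ * h) (q2 : p 2 x₁ x₂ x₃ x₄ = b₂ * h ^ 2)
    (q3 : p 3 x₁ x₂ x₃ x₄ = b₃ * h ^ 3) (q4 : p 4 x₁ x₂ x₃ x₄ = b₄ * h ^ 4 + w') :
    e₁ x₁ x₂ x₃ x₄ = b₁ * h ∧
    2 * e₂ x₁ x₂ x₃ x₄ = (b₁ ^ 2 - b₂) * h ^ 2 ∧
    6 * e₃ x₁ x₂ x₃ x₄ = (b₁ ^ 3 - 3 * b₁ * b₂ + 2 * b₃) * h ^ 3 ∧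
    24 * e₄ x₁ x₂ x₃ x₄ = (b₁ ^ 4 - 6 * b₁ ^ 2 * b₂ + 3 * b₂ ^ 2 + 8 * b₁ * b₃ - 6 * b₄) * h ^ 4 - 6 * w' := by
  obtain ⟨E2, E3, E4⟩ := e_from_p x₁ x₂ x₃ x₄
  have E1 := newton₁ x₁ x₂ x₃ x₄
  refine ⟨?_, ?_, ?_, ?_⟩
  · rw [← E1, q1]
  · rw [E2, q1, q2]; ring
  · rw [E3, q1, q2, q3]; ring
  · rw [E4, q1, q2, q3, q4]; ring

/-- consequence used in the memo (§1.2): with clean power sums in degrees `≤ 3`, `e₄` is clean (no `W`-part)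
iff `6·w' = 0`, i.e. (over a `ℚ`-algebra) iff the `W`-part `w'` of `p₄ = 24·ch₄` vanishes — so «μ ≠ 0 on `ch₄`» and
«`w ≠ 0` in `e₄ = c₄`» are the same condition. -/
theorem e₄_clean_iff (x₁ x₂ x₃ x₄ b₁ b₂ b₃ b₄ h w' : A)
    (q1 : p 1 x₁ x₂ x₃ x₄ = b₁ * h) (q2 : p 2 x₁ x₂ x₃ x₄ = b₂ * h ^ 2)
    (q3 : p 3 x₁ x₂ x₃ x₄ = b₃ * h ^ 3) (q4 : p 4 x₁ x₂ x₃ x₄ = b₄ * h ^ 4 + w') :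
    (24 * e₄ x₁ x₂ x₃ x₄ = (b₁ ^ 4 - 6 * b₁ ^ 2 * b₂ + 3 * b₂ ^ 2 + 8 * b₁ * b₃ - 6 * b₄) * h ^ 4) ↔ 6 * w' = 0 := by
  have E := (transfer_W_part x₁ x₂ x₃ x₄ b₁ b₂ b₃ b₄ h w' q1 q2 q3 q4).2.2.2
  rw [E]; constructor
  · intro H; linear_combination (-1 : A) * H
  · intro H; linear_combination (-1 : A) * H

end Transfer

/-! ## §3 The eigenvector step in coordinates: diagonal operators and the corner `N = α E_AB + β E_BA` -/

section Corner

variable {K : Type*} [Field K] {ι : Type*}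

/-- In the decomposable eigenbasis `u_S` the operator `Φ₄(G(ω_b))` is DIAGONAL (`diag d`); a θ-eigenvector is then
supported on `{S : d S = θ}`.  (Pencil: so a SIMPLE eigenvalue has its eigenvector proportional to ONE `u_S`, a
decomposable 4-vector.) -/
theorem support_of_diag_eigen (d x : ι → K) (θ : K) (hx : ∀ i, d i * x i = θ * x i) (i : ι) (hi : d i ≠ θ) :
    x i = 0 := by
  have h : (d i - θ) * x i = 0 := by rw [sub_mul, hx i, sub_self]
  rcases mul_eq_zero.mp h with h0 | h0
  · exact absurd (sub_eq_zero.mp h0) hi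
  · exact h0

/-- bookkeeping for the nilpotent corner (memo §1.4 (ii)): a diagonal entry that kills every scalar is zero — so a
diagonalizable operator with no non-zero eigenvalue is the zero operator, and cannot equal a non-zero nilpotent. -/
theorem diag_entry_zero_of_kills_all (d : ι → K) (i : ι) (h : ∀ x : K, d i * x = 0) : d i = 0 := by
  simpa using h 1

variable (A B : ι) (α β θ : K) (v : ι → K)

/-- **CORNER, support.** For `N = α E_AB + β E_BA` (`(Nv)_A = α v_B`, `(Nv)_B = β v_A`, `(Nv)_S = 0` otherwise) a
θ-eigenvector with `θ ≠ 0` vanishes off `{A, B}`. -/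
theorem corner_support (hθ : θ ≠ 0) (hS : ∀ S, S ≠ A → S ≠ B → (0 : K) = θ * v S)
    (S : ι) (hA : S ≠ A) (hB : S ≠ B) : v S = 0 := by
  have h := hS S hA hB
  rcases mul_eq_zero.mp h.symm with h0 | h0
  · exact absurd h0 hθ
  · exact h0

/-- **CORNER, both pure coordinates.** With `θ ≠ 0`: `v_A = 0 ↔ v_B = 0` — a θ-eigenvector of the corner has BOTH
pure coordinates `e_A`, `e_B` non-zero (or is zero on the corner).  Pencil + engine (c): such a 4-vector
`v_A e_A + v_B e_B`, `v_A v_B ≠ 0`, is NOT decomposable (annihilator rank 8 ≠ 4). -/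
theorem corner_both_or_none (hθ : θ ≠ 0) (hA : α * v B = θ * v A) (hB : β * v A = θ * v B) :
    v A = 0 ↔ v B = 0 := by
  constructor
  · intro h0
    have : θ * v B = 0 := by rw [← hB, h0, mul_zero]
    rcases mul_eq_zero.mp this with h | h
    · exact absurd h hθ
    · exact h
  · intro h0
    have : θ * v A = 0 := by rw [← hA, h0, mul_zero]
    rcases mul_eq_zero.mp this with h | h
    · exact absurd h hθ
    · exact h

/-- **CORNER, eigenvalue.** A θ-eigenvector with `v_A ≠ 0` forces `θ² = αβ`; in particular if exactly one of
`α, β` vanishes (the non-real case of the memo) the corner has NO non-zero eigenvalue: it is a non-zero nilpotent,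
hence not diagonalizable. -/
theorem corner_eigenvalue_sq (hA : α * v B = θ * v A) (hB : β * v A = θ * v B) (hvA : v A ≠ 0) :
    θ ^ 2 = α * β := by
  have h : (θ ^ 2 - α * β) * v A = 0 := by
    have e1 : θ * (θ * v A) = θ * (α * v B) := by rw [hA]
    have e2 : α * (θ * v B) = α * (β * v A) := by rw [hB]
    linear_combination e1 + e2
  rcases mul_eq_zero.mp h with h0 | h0
  · exact sub_eq_zero.mp h0
  · exact absurd h0 hvA

theorem corner_no_eigenvector_if_nilpotent (hθ : θ ≠ 0) (hαβ : α * β = 0)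
    (hA : α * v B = θ * v A) (hB : β * v A = θ * v B)
    (hS : ∀ S, S ≠ A → S ≠ B → (0 : K) = θ * v S) : v = 0 := by
  funext S
  by_cases hSA : S = A
  · subst hSA
    by_contra hvA
    have := corner_eigenvalue_sq S B α β θ v hA hB hvA
    rw [hαβ] at this
    exact hθ (pow_eq_zero_iff (n := 2) (by norm_num) |>.mp this)
  · by_cases hSB : S = B
    · subst hSB
      by_contra hvB
      have hvA : v A ≠ 0 := fun h0 => hvB ((corner_both_or_none A S α β θ v hθ hA hB).mp h0)
      have := corner_eigenvalue_sq A S α β θ v hA hB hvA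
      rw [hαβ] at this
      exact hθ (pow_eq_zero_iff (n := 2) (by norm_num) |>.mp this)
    · exact corner_support A B θ v hθ hS S hSA hSB

/-- **CORNER, simplicity.** Two θ-eigenvectors (`θ ≠ 0`) of the corner are proportional: the θ-eigenspace is a
LINE (so, when `M = Φ₄(G(ω_b)) = N`, it is spanned by ONE decomposable `u_S` — contradiction with
`corner_both_or_none` + engine (c)). -/
theorem corner_simple (hθ : θ ≠ 0) (v' : ι → K)
    (hA : α * v B = θ * v A) (hB : β * v A = θ * v B) (hS : ∀ S, S ≠ A → S ≠ B → (0 : K) = θ * v S)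
    (hB' : β * v' A = θ * v' B) (hS' : ∀ S, S ≠ A → S ≠ B → (0 : K) = θ * v' S)
    (hvA : v A ≠ 0) : v' = (v' A / v A) • v := by
  funext S
  simp only [Pi.smul_apply, smul_eq_mul]
  by_cases hSA : S = A
  · subst hSA; field_simp
  · by_cases hSB : S = B
    · subst hSB
      -- v_B = β v_A / θ and v'_B = β v'_A / θ
      have e1 : v S = β * v A / θ := by field_simp; linear_combination (-1 : K) * hB
      have e2 : v' S = β * v' A / θ := by field_simp; linear_combination (-1 : K) * hB'
      rw [e1, e2]; field_simp
    · rw [corner_support A B θ v hθ hS S hSA hSB, corner_support A B θ v' hθ hS' S hSA hSB, mul_zero]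

end Corner

end HsemiregIsogeny1.CleanCE4
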